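import Literature.AlgebraicGeometry.HodgeTheory.HodgeGenericQbarDescentFiniteMonodromyInputs
import Literature.AlgebraicGeometry.HodgeTheory.AlgebraicClassesFibreRestriction
import HarnessLib

/-!
# Voisin 2007, Prop. 0.7 from Riemann existence over `ℂ`, descent UP TO HOMEOMORPHISM, and the partie fixe

Family `hodge`, layer `Literature/AlgebraicGeometry/HodgeTheory`. Proof file (sorry-free, theorems
only, no definition, no named fact) of the unit `voisin2007_algebraic_of_finite_monodromyOrbit_of_qbar`
(`HodgeGenericQbarDescent.lean`; C. Voisin, *Hodge loci and absolute Hodge classes*, Compositio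
Math. 143 (2007), §3, proof of Prop. 0.7 = arXiv math/0605766 Prop. 1.7), on the COVERING branch of
the assembled proof (`HodgeGenericQbarDescentFiniteMonodromyProofs.voisin2007_algebraic_of_finite_monodromyOrbit_of_qbar_of_inputs`:
the finite covering `T → S(ℂ)` trivialising the monodromy of `α` is CONSTRUCTED as the path
component of `(s, α)` in the espace étalé, so no classification of covering spaces is needed).
Two refinements of that assembly:

* `voisin2007_algebraic_of_finite_monodromyOrbit_of_qbar_of_coveringInput (hRE) (hGICT) (hpol)` —
  `…_of_inputs` with its compactification input DISCHARGED (Hironaka over `ℚ̄`, PROVED: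
  `exists_smoothProjective_baseChangeHom_compactification_familyPullback_of_isQuasiProjectiveOver`)
  and its pull-back input DISCHARGED (the only pull-back used, along the inclusion of a fibre of
  the base-changed family into the smooth compactification, is the tree's PROVED
  `map_fiberι_comp_mem_algebraicClasses_of_isSmoothProjective` — no moving lemma), the rest of the
  proof repeated step by step;
* `voisin2007_algebraic_of_finite_monodromyOrbit_of_qbar_of_riemannExistence_of_weakDescent
  (hRiemann) (hDescent) (hGICT)` — **the named fact from Riemann's existence theorem over `ℂ`
  (SGA1 XII Thm. 5.1, covering form), the descent of finite étale covers of `S₀ ⊗_{ℚ̄} ℂ` to `ℚ̄`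
  UP TO HOMEOMORPHISM OVER `S(ℂ)` (`hDescent`: for `g : S' → S₀ ⊗_σ ℂ` finite étale with `S'`
  connected there is a finite étale `g₀ : S''₀ → S₀` over `ℚ̄` and a homeomorphism
  `S''₀(ℂ) ≃ₜ S'(ℂ)` commuting with the projections to `S(ℂ)` — all that the covering branch
  consumes, and WEAKER than SGA1 XIII Prop. 4.6, which gives an isomorphism of schemes), and
  Deligne's global invariant cycle theorem (`deligne_globalInvariantCycles`)**; the polarisability
  being the tree's theorem `smoothProjective_hodgeStructure_isPolarizable_holds`.

The weak descent is the form delivered by the specialisation argument (spread the cover over a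
smooth `ℚ̄`-variety `B`, specialise at a `ℚ̄`-point, transport along a path in `B(ℂ)`:
`Topology/CoveringSpaces/CoveringSliceTransport`, `Motives/ComplexPointsFiniteEtaleCovering`),
which needs no comparison of étale and topological fundamental groups.

## References

* [Voisin2007HodgeLoci] C. Voisin, Hodge loci and absolute Hodge classes, Compositio Math. 143
  (2007), §3, proof of Prop. 0.7 (arXiv math/0605766: Prop. 1.7, p. 7).
* [SGA1] A. Grothendieck, M. Raynaud, SGA 1 (arXiv:math/0206203), Exp. XII Thm. 5.1, Exp. XIII
  Prop. 4.6.
* [DeligneHodgeII1971] P. Deligne, Théorie de Hodge II, Publ. Math. IHÉS 40 (1971), Thm. 4.1.1.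
* [Hironaka1964] H. Hironaka, Ann. of Math. 79 (1964), Main Theorem I.
* [CharlesSchnell2014Notes] F. Charles, C. Schnell, Notes on absolute Hodge classes, Prop. 11.3.11
  (proof), Thm. 11.3.19 (proof).
* [VoisinHodgeII2003] C. Voisin, Hodge Theory and Complex Algebraic Geometry II, Lemma 4.17.
-/

noncomputable section

open CategoryTheory AlgebraicGeometry
open _root_.Topology _root_.Filter
open Literature.AlgebraicTopology.SingularHomology
open Literature.Topology.CoveringSpaces

namespace Literature.AlgebraicGeometry.HodgeTheory

open Literature.AlgebraicGeometry.Motives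

section CoveringInput

/-- **Voisin 2007, Prop. 0.7 from the covering input alone (plus the partie fixe and the
polarisability).** The assembly `voisin2007_algebraic_of_finite_monodromyOrbit_of_qbar_of_inputs`
(finite orbit ⟹ the path component `T` of `(s, α)` is a connected finite covering of `S(ℂ)`;
`T = S''₀(ℂ)` for a finite étale `S''₀ → S₀` over `ℚ̄` (`hRE`); invariance of the transferred class
on the base-changed family; continuous section; Hodge lift on a smooth projective compactification
defined over `ℚ̄`; the Hodge conjecture over `ℚ̄`; restriction to the fibre) with the
compactification supplied by the tree's Hironaka theorem over `ℚ̄`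
(`exists_smoothProjective_baseChangeHom_compactification_familyPullback_of_isQuasiProjectiveOver`)
and the restriction to the fibre by the tree's
`map_fiberι_comp_mem_algebraicClasses_of_isSmoothProjective` (specialisation of supported classes,
no moving lemma), so that the only anonymous hypothesis left is the covering input `hRE` (Riemann
existence + descent to `ℚ̄`, covering form): "there is an étale cover `S''` of the smooth part of
`S'`, also defined over `ℚ̄`, on which this monodromy action becomes trivial … The global invariant
cycle theorem now says that there exists a Hodge class `β` on a smooth compactification
`𝒳̄_{S''}`, which we may assume defined over `ℚ̄`, restricting to `α`. If the Hodge conjecture is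
true for Hodge classes on varieties defined over `ℚ̄`, it is then true for `β` and thus also for `α`."
[cite: Voisin2007HodgeLoci, §3, proof of Prop. 1.7 (arXiv math/0605766 p. 7; Compositio Prop. 0.7)]
[cite: CharlesSchnell2014Notes, Thm. 11.3.19 (proof) and Prop. 11.3.11 (proof)]
[cite: SGA1, Exp. XII Thm. 5.1 and Exp. XIII Prop. 4.6] [cite: VoisinHodgeII2003, Lemma 4.17]
[cite: Hironaka1964, Main Theorem I] [cite: DeligneHodgeII1971, Théorème 4.1.1] -/
theorem voisin2007_algebraic_of_finite_monodromyOrbit_of_qbar_of_coveringInput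
    (hRE : ∀ (σ : AlgebraicClosure ℚ →+* ℂ) (S₀ : SchemeOver (AlgebraicClosure ℚ)),
      IsQuasiProjectiveOver S₀ → AlgebraicGeometry.Smooth S₀.hom → IrreducibleSpace S₀.left →
      ∀ (T : Type) [TopologicalSpace T] [ConnectedSpace T]
        (q : T → ComplexPoints ((baseChangeHom σ).obj S₀)),
        IsCoveringMap q → (∀ t, (q ⁻¹' {t}).Finite) →
        ∃ (S''₀ : SchemeOver (AlgebraicClosure ℚ)) (g₀ : S''₀ ⟶ S₀)
          (Φ : ComplexPoints ((baseChangeHom σ).obj S''₀) ≃ₜ T),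
          IsFinite g₀.left ∧ Etale g₀.left ∧ IsQuasiProjectiveOver S''₀ ∧
            ∀ z, q (Φ z) = AlgPoints.map ((baseChangeHom σ).map g₀) z)
    (hGICT : deligne_globalInvariantCycles) (hpol : smoothProjective_hodgeStructure_isPolarizable) :
    voisin2007_algebraic_of_finite_monodromyOrbit_of_qbar := by
  intro σ 𝒳₀ S₀ f₀ n p h𝒳₀ hS₀ hS₀irr hS₀sm hf s α hαrat hαhdg hfin hH
  /- Step 0: `S = S₀ ⊗_σ ℂ` is quasi-projective and smooth of the pure dimension `d` of `S₀`;
  `R²ᵖ f_* ℂ` is a local system on `S(ℂ)`, which is locally path connected. -/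
  haveI := hS₀irr
  haveI := hS₀sm
  obtain ⟨d, hd⟩ := Motives.exists_smoothOfRelativeDimension_of_smooth S₀.hom
  haveI := hd
  have hS : IsQuasiProjectiveOver ((baseChangeHom σ).obj S₀) := hS₀.baseChangeHom σ
  haveI : SmoothOfRelativeDimension d ((baseChangeHom σ).obj S₀).hom :=
    smoothOfRelativeDimension_baseChangeHom_hom σ d S₀
  haveI : LocallyOfFiniteType ((baseChangeHom σ).obj S₀).hom := hS.locallyOfFiniteType
  haveI : IsSeparated ((baseChangeHom σ).obj S₀).hom := hS.isVarietyPair_ofScheme.isSeparated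
  have hU : IsCohomologicallyLocallyTrivialOn ((baseChangeHom σ).map f₀)
      (Set.univ : Set (ComplexPoints ((baseChangeHom σ).obj S₀))) :=
    isCohomologicallyLocallyTrivialOn_univ_of_isSmoothProjectiveFamily _ d hf hS
  haveI : LocallyPathConnectedSpace (ComplexPoints ((baseChangeHom σ).obj S₀)) := by
    letI := Motives.ComplexPoints.chartedSpace ((baseChangeHom σ).obj S₀) d
    exact ChartedSpace.locallyPathConnectedSpace (EuclideanSpace ℝ (Fin (2 * d))) _
  /- Step 1: the path component `T` of `x₀ = (s, α)` in the espace étalé is a connected finite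
  covering of `S(ℂ)`. -/
  set x₀ : FiberClass ((baseChangeHom σ).map f₀) (2 * p) := ⟨s, α⟩ with hx₀
  obtain ⟨hq, hqfin⟩ :=
    isCoveringMap_restrict_pt_pathComponent_and_finite ((baseChangeHom σ).map f₀) (2 * p) hU s α hfin
  haveI := connectedSpace_pathComponent x₀
  /- Step 2: Riemann existence and descent: `T = S''(ℂ)` for a finite étale `S''₀ → S₀` over `ℚ̄`. -/
  obtain ⟨S''₀, g₀, Φ, hfinite, hetale, hS''₀, hΦ⟩ :=
    hRE σ S₀ hS₀ hS₀sm hS₀irr (pathComponent x₀) ((pathComponent x₀).restrict FiberClass.pt) hq hqfin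
  haveI := hfinite
  haveI := hetale
  set g : (baseChangeHom σ).obj S''₀ ⟶ (baseChangeHom σ).obj S₀ := (baseChangeHom σ).map g₀ with hg
  have hS'' : IsQuasiProjectiveOver ((baseChangeHom σ).obj S''₀) := hS''₀.baseChangeHom σ
  haveI : LocallyOfFiniteType ((baseChangeHom σ).obj S''₀).hom := hS''.locallyOfFiniteType
  haveI : IsSeparated ((baseChangeHom σ).obj S''₀).hom := hS''.isVarietyPair_ofScheme.isSeparated
  haveI : QuasiCompact ((baseChangeHom σ).obj S''₀).hom := hS''.isVarietyPair_ofScheme.quasiCompact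
  haveI : CompactSpace ((baseChangeHom σ).obj S''₀).left :=
    QuasiCompact.compactSpace_of_compactSpace ((baseChangeHom σ).obj S''₀).hom
  haveI : Etale g.left := etale_baseChangeHom_map_left σ g₀
  haveI : SmoothOfRelativeDimension d ((baseChangeHom σ).obj S''₀).hom := by
    have h : SmoothOfRelativeDimension (0 + d) (g.left ≫ ((baseChangeHom σ).obj S₀).hom) :=
      inferInstance
    rw [Nat.zero_add, Over.w g] at h
    exact h
  have hS''sm : AlgebraicGeometry.Smooth ((baseChangeHom σ).obj S''₀).hom :=
    SmoothOfRelativeDimension.smooth d _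
  /- Step 3: the base-changed family `π' : 𝒳 ×_S S'' ⟶ S''`, again smooth projective, with
  `R²ᵖ π'_* ℂ` a local system; `g(ℂ)` is a local homeomorphism; `S''(ℂ) ≃ T` is path connected. -/
  set π' : familyPullback ((baseChangeHom σ).map f₀) g ⟶ (baseChangeHom σ).obj S''₀ :=
    familyPullback.snd ((baseChangeHom σ).map f₀) g with hπ'
  have hf' : IsSmoothProjectiveFamily π' n := hf.familyPullback_snd g
  haveI := hf'.smoothOfRelativeDimension
  haveI := hf'.isProper
  have hU' : IsCohomologicallyLocallyTrivialOn π'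
      (Set.univ : Set (ComplexPoints ((baseChangeHom σ).obj S''₀))) :=
    isCohomologicallyLocallyTrivialOn_univ π' n d
  have hgloc : IsLocalHomeomorph (AlgPoints.map g :
      ComplexPoints ((baseChangeHom σ).obj S''₀) → ComplexPoints ((baseChangeHom σ).obj S₀)) :=
    Motives.ComplexPoints.isLocalHomeomorph_map d g
  haveI : LocallyPathConnectedSpace (ComplexPoints ((baseChangeHom σ).obj S''₀)) := by
    letI := Motives.ComplexPoints.chartedSpace ((baseChangeHom σ).obj S''₀) d
    exact ChartedSpace.locallyPathConnectedSpace (EuclideanSpace ℝ (Fin (2 * d))) _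
  haveI : PathConnectedSpace (ComplexPoints ((baseChangeHom σ).obj S''₀)) := by
    haveI : PathConnectedSpace (pathComponent x₀) :=
      isPathConnected_iff_pathConnectedSpace.1 isPathConnected_pathComponent
    exact Φ.symm.surjective.pathConnectedSpace Φ.symm.continuous
  /- Step 4: the base point `s''₀` over `s` and the class `α'` on the fibre of `π'` over it. -/
  set s''₀ : ComplexPoints ((baseChangeHom σ).obj S''₀) := Φ.symm ⟨x₀, mem_pathComponent_self x₀⟩
    with hs''₀
  have hΦs : Φ s''₀ = ⟨x₀, mem_pathComponent_self x₀⟩ := Φ.apply_symm_apply _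
  have hgs : AlgPoints.map g s''₀ = s := by
    rw [← hΦ s''₀, hΦs]
    rfl
  set e : fiberOver π' s''₀ ≅ fiberOver ((baseChangeHom σ).map f₀) (AlgPoints.map g s''₀) :=
    fiberOverFamilyPullbackIso ((baseChangeHom σ).map f₀) g s''₀ with he
  set α₁ : complexBetti (fiberOver ((baseChangeHom σ).map f₀) (AlgPoints.map g s''₀)) (2 * p) :=
    x₀.clsAt hgs.symm with hα₁
  have hx₀eq : (⟨AlgPoints.map g s''₀, α₁⟩ : FiberClass ((baseChangeHom σ).map f₀) (2 * p)) = ⟨s, α⟩ :=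
    FiberClass.mk_clsAt x₀ hgs.symm
  set α' : complexBetti (fiberOver π' s''₀) (2 * p) := complexBetti.map e.hom (2 * p) α₁ with hα'
  have h₀ : (⟨s, α⟩ : FiberClass ((baseChangeHom σ).map f₀) (2 * p)) =
      FiberClass.baseChange ((baseChangeHom σ).map f₀) g (2 * p) ⟨s''₀, α'⟩ := by
    change (⟨s, α⟩ : FiberClass ((baseChangeHom σ).map f₀) (2 * p)) =
      ⟨AlgPoints.map g s''₀, complexBetti.map e.inv (2 * p) (complexBetti.map e.hom (2 * p) α₁)⟩
    rw [e.complexBetti_map_inv_map_hom, hx₀eq]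
  /- Step 5: `α'` is invariant under the monodromy of `π'`: a loop at `s''₀` maps by `Φ` to a LOOP in
  `T` through `x₀`, which is the lift of its image in `S(ℂ)`; transport commutes with base change. -/
  have hinv : ∀ γ' : Path.Homotopic.Quotient
      (⟨s''₀, Set.mem_univ _⟩ : (Set.univ : Set (ComplexPoints ((baseChangeHom σ).obj S''₀))))
      ⟨s''₀, Set.mem_univ _⟩, transportFun π' (2 * p) hU' γ' α' = α' := by
    intro γ'
    induction γ' using Quotient.ind with | _ γ' => ?_
    have hΓc : Continuous fun u ↦ (Φ (γ' u).1).1.pt :=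
      (FiberClass.continuous_pt _ _).comp (continuous_subtype_val.comp
        (Φ.continuous.comp (continuous_subtype_val.comp γ'.continuous)))
    let γ : Path (⟨s, Set.mem_univ s⟩ : (Set.univ : Set (ComplexPoints ((baseChangeHom σ).obj S₀))))
        ⟨s, Set.mem_univ s⟩ :=
      { toFun := fun u ↦ ⟨(Φ (γ' u).1).1.pt, Set.mem_univ _⟩
        continuous_toFun := hΓc.subtype_mk _
        source' := by
          apply Subtype.ext
          change (Φ (γ' 0).1).1.pt = s
          rw [γ'.source]
          change (Φ s''₀).1.pt = s
          rw [hΦs]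
        target' := by
          apply Subtype.ext
          change (Φ (γ' 1).1).1.pt = s
          rw [γ'.target]
          change (Φ s''₀).1.pt = s
          rw [hΦs] }
    have hγ : ∀ u, AlgPoints.map g (γ' u).1 = (γ u).1 := fun u ↦ (hΦ (γ' u).1).symm
    have hα : transportFun ((baseChangeHom σ).map f₀) (2 * p) hU ⟦γ⟧ α = α :=
      transportFun_eq_self_of_loop_to_pathComponent ((baseChangeHom σ).map f₀) (2 * p) hU
        (fun z : (Set.univ : Set (ComplexPoints ((baseChangeHom σ).obj S''₀))) ↦ Φ z.1)
        (Φ.continuous.comp continuous_subtype_val) (a := ⟨s''₀, Set.mem_univ _⟩)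
        (by change (Φ s''₀).1 = x₀; rw [hΦs]) γ' γ (fun _ ↦ rfl)
    have key := FiberClass.baseChange_transportFun ((baseChangeHom σ).map f₀) g (2 * p) hgloc hU hU'
      γ γ' hγ α' h₀
    rw [hα] at key
    have key' := (FiberClass.mk_eq_mk_iff _ _).1 (h₀.symm.trans key)
    have h3 := congrArg (complexBetti.map e.hom (2 * p)) key'
    rw [e.complexBetti_map_hom_map_inv, e.complexBetti_map_hom_map_inv] at h3
    exact h3.symm
  /- Step 6: `α'` extends to a continuous section `α̃` of `FiberClass π' (2p)` over `S''(ℂ)`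
  (Lemma 4.17), with value a Hodge class at `s''₀`. -/
  obtain ⟨σ', hσ'c, hσ'pt, hσ'₀⟩ :=
    exists_continuous_section_of_forall_transportFun_eq π' (2 * p) hU' s''₀ α' hinv
  have hα₁ : IsRationalClass α₁ ∧ IsOfHodgeType n
      (fiberOver ((baseChangeHom σ).map f₀) (AlgPoints.map g s''₀)) (2 * p) p p α₁ :=
    (FiberClass.prop_iff_of_mk_eq (fun t a ↦ IsRationalClass a ∧
      IsOfHodgeType n (fiberOver ((baseChangeHom σ).map f₀) t) (2 * p) p p a) hx₀eq).2 ⟨hαrat, hαhdg⟩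
  have hα'h : IsRationalClass α' ∧ IsOfHodgeType n (fiberOver π' s''₀) (2 * p) p p α' :=
    ⟨(isRationalClass_map_iff_of_iso e).2 hα₁.1, (isOfHodgeType_map_iff_of_iso e).2 hα₁.2⟩
  have hloc : σ' s''₀ ∈ locusOfHodgeClasses π' n p := by
    rw [hσ'₀]
    exact hα'h
  /- Step 7: a smooth projective compactification `𝒳̄ = 𝒳̄₀ ⊗_σ ℂ` of `𝒳 ×_S S''`, defined over `ℚ̄`. -/
  haveI : IrreducibleSpace ((baseChangeHom σ).obj S''₀).left :=
    irreducibleSpace_baseChangeHom_obj_left_of_connectedSpace_complexPoints σ g₀ hS''₀ hS₀sm hetale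
      inferInstance
  obtain ⟨m, Xbar₀, i, hXbar₀, hi⟩ :=
    exists_smoothProjective_baseChangeHom_compactification_familyPullback_of_isQuasiProjectiveOver
      σ f₀ g₀ n h𝒳₀ hS₀ hS''₀ hS₀sm hetale inferInstance hf
  have hXbar : IsSmoothProjective m ((baseChangeHom σ).obj Xbar₀) :=
    IsSmoothProjective.baseChangeHom_holds σ hXbar₀
  /- Step 8: the Hodge lift `β ∈ Hdg²ᵖ(𝒳̄)` restricting to `α'` (partie fixe + polarisation). -/
  obtain ⟨β, hβrat, hβhdg, hβ⟩ :=
    hGICT.exists_hodgeClass_eq_globalSection_of_exists_isReal_hodgeModel exists_isReal_hodgeModel_holds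
      hodgePQ_independent_of_hodgeModel_holds hpol π' i hf' hS'' hS''sm hXbar hi hσ'c hσ'pt hloc
  have hα'β : α' = complexBetti.map (fiberι π' s''₀ ≫ i) (2 * p) β := by
    rw [hσ'₀] at hβ
    have h1 := (FiberClass.mk_eq_mk_iff _ _).1 hβ
    rw [h1, complexBetti.map_comp]
    rfl
  /- Step 9: `β` is algebraic by `(H)`; so is its restriction `α'` to the fibre — PROVED
  (`map_fiberι_comp_mem_algebraicClasses_of_isSmoothProjective`: flat restriction to the open
  subfamily and specialisation of supported classes along curves over the smooth irreducible base
  `S''`), and so is `α` along `X''_{s''₀} ≅ X_{g s''₀} = X_s`. -/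
  have hβalg : β ∈ algebraicClasses ((baseChangeHom σ).obj Xbar₀) p := hH hXbar p β hβrat hβhdg
  haveI := hi
  haveI : AlgebraicGeometry.Smooth ((baseChangeHom σ).obj S''₀).hom := hS''sm
  have hα'alg : α' ∈ algebraicClasses (fiberOver π' s''₀) p := by
    rw [hα'β]
    exact map_fiberι_comp_mem_algebraicClasses_of_isSmoothProjective π' hf' hS'' hXbar i hβalg s''₀
  have hα₁alg : α₁ ∈ algebraicClasses (fiberOver ((baseChangeHom σ).map f₀) (AlgPoints.map g s''₀)) p :=
    (mem_algebraicClasses_map_iff_of_iso e).1 hα'alg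
  exact (FiberClass.prop_iff_of_mk_eq
    (fun t a ↦ a ∈ algebraicClasses (fiberOver ((baseChangeHom σ).map f₀) t) p) hx₀eq).1 hα₁alg

end CoveringInput

/-! ### The covering input from Riemann existence over `ℂ` and descent up to homeomorphism -/

section WeakDescent

open Literature.AlgebraicGeometry.Resolution CategoryTheory.Limits

/-- **The covering input `hRE` from Riemann's existence theorem over `ℂ` and descent UP TO
HOMEOMORPHISM.** Let `q : T → S(ℂ)` be a connected finite topological covering of the complex
points of `S = S₀ ⊗_σ ℂ`, `S₀` a smooth irreducible quasi-projective `ℚ̄`-scheme. By Riemann's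
existence theorem (`hRiemann`, SGA1 XII Thm. 5.1) `T ≃ₜ S'(ℂ)` over `S(ℂ)` for a finite étale
`g : S' → S`; by the weak descent (`hDescent`: a finite étale cover of `S₀ ⊗_σ ℂ` is homeomorphic
OVER `S(ℂ)` to the complexification of a finite étale cover of `S₀` — a consequence of SGA1 XIII
Prop. 4.6, and all that is used of it) `S'(ℂ) ≃ₜ S''₀(ℂ)` over `S(ℂ)` for a finite étale
`g₀ : S''₀ → S₀` over `ℚ̄`; composing, `T ≃ₜ S''₀(ℂ)` over `S(ℂ)`. Moreover `S''₀` is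
quasi-projective: `S''₀ ⊗_σ ℂ` is smooth (étale over the smooth `S`) with connected complex points
(`≃ₜ T`), hence irreducible (`irreducibleSpace_left_of_connectedSpace_complexPoints`), so `S''₀` is
irreducible, reduced (smooth over `ℚ̄`), integral, and `g₀` is finite and surjective onto the
quasi-projective `S₀` (`isQuasiProjectiveOver_of_isFinite_of_surjective`). Compare
`finiteCovering_descends_to_qbar_of_riemannExistence_of_smooth` (descent as an isomorphism of
schemes). [cite: SGA1, Exp. XII Thm. 5.1 (p. 333) and Exp. XIII Prop. 4.6 (p. 421)]
[cite: DeJong1996, 4.17 (p. 72)] -/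
theorem finiteCovering_descends_to_qbar_of_riemannExistence_of_weakDescent
    (hRiemann : ∀ (S : SchemeOver ℂ), IsQuasiProjectiveOver S →
      ∀ (T : Type) [TopologicalSpace T] (q : T → ComplexPoints S),
        IsCoveringMap q → (∀ t, (q ⁻¹' {t}).Finite) →
        ∃ (S' : SchemeOver ℂ) (g : S' ⟶ S) (Φ : ComplexPoints S' ≃ₜ T),
          IsFinite g.left ∧ Etale g.left ∧ ∀ z, q (Φ z) = AlgPoints.map g z)
    (hDescent : ∀ (σ : AlgebraicClosure ℚ →+* ℂ) (S₀ : SchemeOver (AlgebraicClosure ℚ)),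
      IsQuasiProjectiveOver S₀ → IrreducibleSpace S₀.left → AlgebraicGeometry.Smooth S₀.hom →
      ∀ ⦃S' : SchemeOver ℂ⦄ (g : S' ⟶ (baseChangeHom σ).obj S₀),
        IsFinite g.left → Etale g.left →
        ∃ (S''₀ : SchemeOver (AlgebraicClosure ℚ)) (g₀ : S''₀ ⟶ S₀)
          (Ψ : ComplexPoints ((baseChangeHom σ).obj S''₀) ≃ₜ ComplexPoints S'),
          IsFinite g₀.left ∧ Etale g₀.left ∧
            ∀ z, AlgPoints.map g (Ψ z) = AlgPoints.map ((baseChangeHom σ).map g₀) z)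
    (σ : AlgebraicClosure ℚ →+* ℂ) (S₀ : SchemeOver (AlgebraicClosure ℚ))
    (hS₀ : IsQuasiProjectiveOver S₀) (hS₀sm : AlgebraicGeometry.Smooth S₀.hom)
    (hS₀irr : IrreducibleSpace S₀.left)
    (T : Type) [TopologicalSpace T] [ConnectedSpace T]
    (q : T → ComplexPoints ((baseChangeHom σ).obj S₀)) (hq : IsCoveringMap q)
    (hqfin : ∀ t, (q ⁻¹' {t}).Finite) :
    ∃ (S''₀ : SchemeOver (AlgebraicClosure ℚ)) (g₀ : S''₀ ⟶ S₀)
      (Φ : ComplexPoints ((baseChangeHom σ).obj S''₀) ≃ₜ T),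
      IsFinite g₀.left ∧ Etale g₀.left ∧ IsQuasiProjectiveOver S''₀ ∧
        ∀ z, q (Φ z) = AlgPoints.map ((baseChangeHom σ).map g₀) z := by
  haveI := hS₀sm
  haveI := hS₀irr
  have hS : IsQuasiProjectiveOver ((baseChangeHom σ).obj S₀) := hS₀.baseChangeHom σ
  -- Riemann existence: `T = S'(ℂ)` for a finite étale `g : S' → S₀ ⊗_σ ℂ`
  obtain ⟨S', g, Φ₁, hfin, het, hΦ₁⟩ := hRiemann _ hS T q hq hqfin
  haveI := hfin
  haveI := het
  -- weak descent: `S'(ℂ) ≃ₜ S''₀(ℂ)` over `S(ℂ)` for a finite étale `g₀ : S''₀ → S₀` over `ℚ̄`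
  obtain ⟨S''₀, g₀, Ψ, hfin₀, het₀, hΨ⟩ := hDescent σ S₀ hS₀ hS₀irr hS₀sm g hfin het
  haveI := hfin₀
  haveI := het₀
  -- `S''₀ ⊗_σ ℂ` is smooth with connected complex points, hence irreducible; so is `S''₀`
  set g' : (baseChangeHom σ).obj S''₀ ⟶ (baseChangeHom σ).obj S₀ := (baseChangeHom σ).map g₀
    with hg'
  haveI : AlgebraicGeometry.Smooth ((baseChangeHom σ).obj S₀).hom := by
    change AlgebraicGeometry.Smooth (Limits.pullback.snd S₀.hom _)
    infer_instance
  haveI : Etale g'.left := etale_baseChangeHom_map_left σ g₀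
  haveI : AlgebraicGeometry.Smooth ((baseChangeHom σ).obj S''₀).hom := by
    rw [← Over.w g']
    infer_instance
  haveI : ConnectedSpace (ComplexPoints ((baseChangeHom σ).obj S''₀)) :=
    (Ψ.trans Φ₁).symm.surjective.connectedSpace (Ψ.trans Φ₁).symm.continuous
  haveI : IrreducibleSpace ((baseChangeHom σ).obj S''₀).left :=
    irreducibleSpace_left_of_connectedSpace_complexPoints
  haveI : IrreducibleSpace S''₀.left := irreducibleSpace_of_irreducibleSpace_baseChangeHom_obj σ S''₀
  -- `S₀` and `S''₀` are integral
  have hS₀reg : Scheme.IsRegular S₀.left :=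
    Scheme.IsRegular.of_smooth S₀.hom (Scheme.isRegular_Spec (CommRingCat.of (AlgebraicClosure ℚ)))
  haveI : IsReduced S₀.left := hS₀reg.isReduced
  haveI : IsIntegral S₀.left := isIntegral_of_irreducibleSpace_of_isReduced _
  haveI : AlgebraicGeometry.Smooth S''₀.hom := by
    rw [← Over.w g₀]
    infer_instance
  have hS''reg : Scheme.IsRegular S''₀.left :=
    Scheme.IsRegular.of_smooth S''₀.hom (Scheme.isRegular_Spec (CommRingCat.of (AlgebraicClosure ℚ)))
  haveI : IsReduced S''₀.left := hS''reg.isReduced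
  haveI : IsIntegral S''₀.left := isIntegral_of_irreducibleSpace_of_isReduced _
  -- `g₀` is surjective: closed (finite) and open (étale) onto the irreducible `S₀`
  haveI : Surjective g₀.left := by
    refine ⟨fun y => ?_⟩
    have huniv : Set.range g₀.left = Set.univ :=
      IsClopen.eq_univ ⟨g₀.left.isClosedMap.isClosed_range, g₀.left.isOpenMap.isOpen_range⟩
        (Set.range_nonempty _)
    show y ∈ Set.range g₀.left
    rw [huniv]
    trivial
  refine ⟨S''₀, g₀, Ψ.trans Φ₁, hfin₀, het₀,
    isQuasiProjectiveOver_of_isFinite_of_surjective g₀ hS₀, fun z ↦ ?_⟩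
  rw [Homeomorph.trans_apply, hΦ₁, hΨ]

/-- **Voisin 2007, Prop. 0.7 (= arXiv Prop. 1.7) from Riemann's existence theorem over `ℂ`,
descent of finite étale covers to `ℚ̄` UP TO HOMEOMORPHISM, and the global invariant cycle
theorem** — `voisin2007_algebraic_of_finite_monodromyOrbit_of_qbar_of_coveringInput` with its
covering input supplied by `finiteCovering_descends_to_qbar_of_riemannExistence_of_weakDescent`
and the polarisability by the tree's `smoothProjective_hodgeStructure_isPolarizable_holds`.
Remaining inputs:

* `hRiemann` — Riemann's existence theorem [SGA1, Exp. XII Thm. 5.1]: a finite topological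
  covering of `S(ℂ)`, `S` quasi-projective over `ℂ`, is `S'(ℂ)` for a finite étale `S' → S`;
* `hDescent` — descent up to homeomorphism over `S(ℂ)` [the part of SGA1, Exp. XIII Prop. 4.6
  that is used]: a finite étale cover of `S₀ ⊗_σ ℂ`, `S₀` smooth irreducible quasi-projective over
  `ℚ̄`, is homeomorphic over `S(ℂ)` to the complexification of a finite étale cover of `S₀`;
* `hGICT` — the named fact `deligne_globalInvariantCycles` [Deligne, Hodge II, Thm. 4.1.1].
[cite: Voisin2007HodgeLoci, §3, proof of Prop. 1.7 (arXiv math/0605766 p. 7; Compositio Prop. 0.7)]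
[cite: SGA1, Exp. XII Thm. 5.1 and Exp. XIII Prop. 4.6] [cite: DeligneHodgeII1971, Théorème 4.1.1]
[cite: VoisinHodgeI2002, Thm. 6.32 and §7.1.2] -/
theorem voisin2007_algebraic_of_finite_monodromyOrbit_of_qbar_of_riemannExistence_of_weakDescent
    (hRiemann : ∀ (S : SchemeOver ℂ), IsQuasiProjectiveOver S →
      ∀ (T : Type) [TopologicalSpace T] (q : T → ComplexPoints S),
        IsCoveringMap q → (∀ t, (q ⁻¹' {t}).Finite) →
        ∃ (S' : SchemeOver ℂ) (g : S' ⟶ S) (Φ : ComplexPoints S' ≃ₜ T),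
          IsFinite g.left ∧ Etale g.left ∧ ∀ z, q (Φ z) = AlgPoints.map g z)
    (hDescent : ∀ (σ : AlgebraicClosure ℚ →+* ℂ) (S₀ : SchemeOver (AlgebraicClosure ℚ)),
      IsQuasiProjectiveOver S₀ → IrreducibleSpace S₀.left → AlgebraicGeometry.Smooth S₀.hom →
      ∀ ⦃S' : SchemeOver ℂ⦄ (g : S' ⟶ (baseChangeHom σ).obj S₀),
        IsFinite g.left → Etale g.left →
        ∃ (S''₀ : SchemeOver (AlgebraicClosure ℚ)) (g₀ : S''₀ ⟶ S₀)
          (Ψ : ComplexPoints ((baseChangeHom σ).obj S''₀) ≃ₜ ComplexPoints S'),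
          IsFinite g₀.left ∧ Etale g₀.left ∧
            ∀ z, AlgPoints.map g (Ψ z) = AlgPoints.map ((baseChangeHom σ).map g₀) z)
    (hGICT : deligne_globalInvariantCycles) :
    voisin2007_algebraic_of_finite_monodromyOrbit_of_qbar :=
  voisin2007_algebraic_of_finite_monodromyOrbit_of_qbar_of_coveringInput
    (fun σ S₀ hS₀ hS₀sm hS₀irr T _ _ q hq hqfin ↦
      finiteCovering_descends_to_qbar_of_riemannExistence_of_weakDescent hRiemann hDescent σ S₀ hS₀
        hS₀sm hS₀irr T q hq hqfin)
    hGICT smoothProjective_hodgeStructure_isPolarizable_holds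

end WeakDescent

end Literature.AlgebraicGeometry.HodgeTheory

end
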